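/-
Copyright (c) 2026 the pub-hodgecm-mathlib formalisation cell (harness21).  Prover seat hodgecm-mathlib-F0P3a-p06 (g20), line LH3 letter L3′, W-road brick (W2) «invariant smooth germ =
class function», sub-brick (W2b) (census binder LH3-p01 (g6), RULING #26); 2026-09-02.
-/
import Mathlib
import HarnessLib

/-!
# Smooth local left inverses of immersion germs, and pushing a smooth germ forward along an immersion to a GLOBAL smooth function
# (inverse function theorem, Lee *Introduction to Smooth Manifolds* Thm. 4.12 ∕ Prop. 4.1; Hörmander ALPDO I Thm. 1.4.1 for the cut-off)

Topic `Analysis/Calculus`; namespace `Literature.Analysis.Calculus`.  THEOREMS ONLY (no `def`, no instance, no notation, no axiom, no named fact, no `sorry`); Mathlib-only.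
Cell `pub/hodgecm-mathlib`, crux H413 = `stmt-HodgeConjecture-24833`; line LH3, letter L3′ (Bouaziz's surjectivity for `H_∞`), W-road (LH3-p01 (g6) W-ROAD CENSUS v1), brick
**(W2b)** of (W2) «invariant smooth germ = class function»: once a smooth germ `H` at `p` has been written in the squared-coordinate variables, it is pushed to a smooth function
`U` on the CLASS space along the squared-coordinate factor `Φ` of the class map (`bzClassMap S = Φ ∘ sq`), which is an IMMERSION at `sq p`; this file is the generic calculus
behind that step.

* §1 `exists_contDiff_eventuallyEq_of_contDiffOn` — a map of class `C^n` on an open set agrees NEAR a point with a GLOBAL `C^n` map (bump cut-off).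
* §2 **`exists_contDiffOn_leftInverse_of_injective_fderiv`** — an immersion germ (`Φ` of class `C^n`, `n ≥ 1`, near `p`, `DΦ(p)` injective; finite-dimensional spaces) has a
  smooth LOCAL LEFT INVERSE: `λ` of class `C^n` on an open neighbourhood of `Φ p` with `λ (Φ x) = x` for `x` near `p` (`π ∘ DΦ(p) = id` for a linear retraction `π`, Mathlib's
  inverse function theorem `HasStrictFDerivAt.toOpenPartialHomeomorph` for `π ∘ Φ`, `λ := (π ∘ Φ)⁻¹_loc ∘ π`; smoothness of the inverse on a whole neighbourhood from
  `OpenPartialHomeomorph.contDiffAt_symm` at every point where the derivative is still invertible — an open condition, `ContinuousLinearEquiv.nhds`).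
* §3 **`exists_nhds_forall_contDiff_comp_eq_of_injective_fderiv`** — PUSH-FORWARD ALONG AN IMMERSION, UNIFORM IN THE GERM: ONE neighbourhood `N ∋ p` (depending on `Φ` only) such that
  every GLOBAL `C^n` map `H` on the source is `U ∘ Φ` on `N` for some GLOBAL `C^n` map `U` on the target (`U := ρ • (H ∘ λ)`, the bump `ρ` and `λ` fixed before `H` — the
  quantifier order «neighbourhood before germ» that a consumer fixing radii before functions needs); `exists_contDiff_comp_eventuallyEq_of_injective_fderiv` — the germ form
  (`H` of class `C^n` near `p` ⟹ global `U` with `U (Φ x) = H x` near `p`).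
HONEST LABEL: HC_CM is proved only modulo the 7 printed citations (2 remaining: hLiu418 = `stmt-HodgeConjecture-24832`, h413 = `stmt-HodgeConjecture-24833`) until rung 0 closes;
generic calculus (count-neutral); (W2) pays nothing until (W2a)(W2b)(W2c) are ★.

## References
* [Lee2012] J. M. Lee, *Introduction to Smooth Manifolds*, 2nd ed., GTM 218 (2012), Thm. 4.12 (rank theorem ∕ local immersions), Prop. 4.1, Lemma 2.26 (extension by bump functions).
* [HormanderALPDO1] L. Hörmander, *The Analysis of Linear Partial Differential Operators I* (1983), Thm. 1.4.1 (cut-off functions).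
-/

set_option autoImplicit false

noncomputable section

open Set Function Metric Filter
open scoped Topology ContDiff

namespace Literature.Analysis.Calculus

section Cutoff

variable {E F : Type*} [NormedAddCommGroup E] [NormedSpace ℝ E] [FiniteDimensional ℝ E] [NormedAddCommGroup F] [NormedSpace ℝ F]

/-- **A `C^n` map on an open set agrees near any of its points with a GLOBAL `C^n` map** (multiply by a smooth bump `= 1` near the point and supported in the open set).
[cite: Lee2012, Lemma 2.26] [cite: HormanderALPDO1, Thm. 1.4.1] -/
theorem exists_contDiff_eventuallyEq_of_contDiffOn {n : ℕ∞} {f : E → F} {U : Set E} (hU : IsOpen U) {x : E} (hx : x ∈ U) (hf : ContDiffOn ℝ n f U) :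
    ∃ g : E → F, ContDiff ℝ n g ∧ g =ᶠ[𝓝 x] f := by
  obtain ⟨r, hr, hrU⟩ : ∃ r > 0, closedBall x (2 * r) ⊆ U := by
    obtain ⟨r, hr, hrU⟩ := Metric.isOpen_iff.1 hU x hx
    refine ⟨r / 4, by positivity, (closedBall_subset_ball (by linarith)).trans hrU⟩
  let χ : ContDiffBump x := ⟨r, 2 * r, hr, by linarith⟩
  refine ⟨fun y => χ y • f y, ?_, ?_⟩
  · rw [contDiff_iff_contDiffAt]
    intro y
    by_cases hy : y ∈ U
    · exact χ.contDiff.contDiffAt.smul (hf.contDiffAt (hU.mem_nhds hy))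
    · -- off `U` the product vanishes near `y` (`tsupport χ = closedBall x (2r) ⊆ U`)
      have hy' : y ∉ tsupport (χ : E → ℝ) := fun h => hy (hrU (by simpa [χ.tsupport_eq] using h))
      have h0 : (fun y => χ y • f y) =ᶠ[𝓝 y] fun _ => 0 := by
        have : (χ : E → ℝ) =ᶠ[𝓝 y] 0 := by
          rw [← notMem_tsupport_iff_eventuallyEq] at *
          exact hy'
        filter_upwards [this] with z hz
        simp only [hz, Pi.zero_apply, zero_smul]
      exact (contDiffAt_const (c := (0 : F))).congr_of_eventuallyEq h0
  · have h1 : ∀ᶠ y in 𝓝 x, χ y = 1 := by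
      filter_upwards [closedBall_mem_nhds x hr] with y hy
      exact χ.one_of_mem_closedBall hy
    filter_upwards [h1] with y hy
    simp only [hy, one_smul]

end Cutoff

section Immersion

variable {X Y : Type*} [NormedAddCommGroup X] [NormedSpace ℝ X] [FiniteDimensional ℝ X] [NormedAddCommGroup Y] [NormedSpace ℝ Y] [FiniteDimensional ℝ Y]

/-- **SMOOTH LOCAL LEFT INVERSE OF AN IMMERSION GERM.**  If `Φ : X → Y` (finite-dimensional real spaces) is of class `C^n`, `n ≥ 1`, on an open set containing `p` and its derivative at
`p` is INJECTIVE, then there are an open `V ∋ Φ p` and `λ : Y → X` of class `C^n` on `V` with `λ (Φ x) = x` for all `x` near `p`.  Proof: a linear retraction `π : Y → X` of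
`DΦ(p)` makes `π ∘ Φ` a local diffeomorphism at `p` (Mathlib `HasStrictFDerivAt.toOpenPartialHomeomorph`); `λ := (π ∘ Φ)⁻¹_loc ∘ π`, smooth on the part of the target where the derivative of
`π ∘ Φ` at the inverse point is still an isomorphism (`OpenPartialHomeomorph.contDiffAt_symm`, `ContinuousLinearEquiv.nhds`). [cite: Lee2012, Thm. 4.12; Prop. 4.1] -/
theorem exists_contDiffOn_leftInverse_of_injective_fderiv {n : WithTop ℕ∞} (hn : 1 ≤ n) {Φ : X → Y} {O : Set X} (hO : IsOpen O) {p : X} (hp : p ∈ O)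
    (hΦ : ContDiffOn ℝ n Φ O) (hinj : Injective (fderiv ℝ Φ p)) :
    ∃ V : Set Y, IsOpen V ∧ Φ p ∈ V ∧ ∃ lam : Y → X, ContDiffOn ℝ n lam V ∧ ∀ᶠ x in 𝓝 p, lam (Φ x) = x := by
  have hn0 : n ≠ 0 := by
    intro h; rw [h] at hn; exact absurd hn (by norm_num)
  -- a continuous linear retraction of the injective derivative
  set D : X →L[ℝ] Y := fderiv ℝ Φ p with hD
  obtain ⟨π₀, hπ₀⟩ := (D : X →ₗ[ℝ] Y).exists_leftInverse_of_injective (LinearMap.ker_eq_bot.2 hinj)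
  set π : Y →L[ℝ] X := LinearMap.toContinuousLinearMap π₀ with hπ
  have hπD : π.comp D = ContinuousLinearMap.id ℝ X := by
    ext x
    have := LinearMap.congr_fun hπ₀ x
    simpa [hπ] using this
  -- `f := π ∘ Φ` has derivative `id` at `p`
  set f : X → X := fun x => π (Φ x) with hf
  have hΦp : ContDiffAt ℝ n Φ p := hΦ.contDiffAt (hO.mem_nhds hp)
  have hfO : ContDiffOn ℝ n f O := π.contDiff.comp_contDiffOn hΦ
  have hfp : ContDiffAt ℝ n f p := hfO.contDiffAt (hO.mem_nhds hp)
  have hDf : HasFDerivAt f ((ContinuousLinearEquiv.refl ℝ X : X ≃L[ℝ] X) : X →L[ℝ] X) p := by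
    have h1 : HasFDerivAt Φ D p := (hΦp.differentiableAt hn0).hasFDerivAt
    have h2 : HasFDerivAt f (π.comp D) p := π.hasFDerivAt.comp p h1
    rw [hπD] at h2
    simpa using h2
  have hstrict : HasStrictFDerivAt f ((ContinuousLinearEquiv.refl ℝ X : X ≃L[ℝ] X) : X →L[ℝ] X) p := hfp.hasStrictFDerivAt' hDf hn0
  set e := hstrict.toOpenPartialHomeomorph f with he
  have he_coe : (e : X → X) = f := hstrict.toOpenPartialHomeomorph_coe
  have hpe : p ∈ e.source := hstrict.mem_toOpenPartialHomeomorph_source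
  have hfpe : f p ∈ e.target := hstrict.image_mem_toOpenPartialHomeomorph_target
  -- the derivative of `f` is an isomorphism NEAR `p` (open condition), inside `O ∩ e.source`
  have hcontD : ContinuousOn (fun x => fderiv ℝ f x) O := hfO.continuousOn_fderiv_of_isOpen hO hn
  set G : Set X := {x | x ∈ O ∩ e.source ∧ ∃ e' : X ≃L[ℝ] X, (e' : X →L[ℝ] X) = fderiv ℝ f x} with hG
  have hGopen : IsOpen G := by
    have h1 : IsOpen (O ∩ e.source) := hO.inter e.open_source
    have h2 : IsOpen (O ∩ (fun x => fderiv ℝ f x) ⁻¹' {L : X →L[ℝ] X | ∃ e' : X ≃L[ℝ] X, (e' : X →L[ℝ] X) = L}) := by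
      refine hcontD.isOpen_inter_preimage hO ?_
      -- the set of invertible maps is open
      rw [isOpen_iff_mem_nhds]
      rintro L ⟨e', rfl⟩
      exact e'.nhds
    have : G = (O ∩ e.source) ∩ (O ∩ (fun x => fderiv ℝ f x) ⁻¹' {L : X →L[ℝ] X | ∃ e' : X ≃L[ℝ] X, (e' : X →L[ℝ] X) = L}) := by
      ext x
      simp only [hG, mem_setOf_eq, mem_inter_iff, mem_preimage]
      tauto
    rw [this]
    exact h1.inter h2
  have hpG : p ∈ G := ⟨⟨hp, hpe⟩, ContinuousLinearEquiv.refl ℝ X, by rw [hDf.fderiv]⟩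
  -- the good part of the target
  set V₀ : Set X := e.target ∩ e.symm ⁻¹' G with hV₀
  have hV₀open : IsOpen V₀ := e.isOpen_inter_preimage_symm hGopen
  have hfpV₀ : f p ∈ V₀ := by
    refine ⟨hfpe, ?_⟩
    show e.symm (f p) ∈ G
    rw [← he_coe, e.left_inv hpe]
    exact hpG
  have hsymm : ContDiffOn ℝ n e.symm V₀ := by
    intro y hy
    have hyG : e.symm y ∈ G := hy.2
    obtain ⟨⟨hyO, _⟩, e', he'⟩ := hyG
    have hd : HasFDerivAt e (e' : X →L[ℝ] X) (e.symm y) := by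
      rw [he_coe, he']
      exact ((hfO.contDiffAt (hO.mem_nhds hyO)).differentiableAt hn0).hasFDerivAt
    have hc : ContDiffAt ℝ n e (e.symm y) := by
      rw [he_coe]; exact hfO.contDiffAt (hO.mem_nhds hyO)
    exact (e.contDiffAt_symm hy.1 hd hc).contDiffWithinAt
  -- `λ := e.symm ∘ π` on `V := π ⁻¹' V₀`
  refine ⟨π ⁻¹' V₀, hV₀open.preimage π.continuous, by simpa [hf] using hfpV₀, fun y => e.symm (π y),
    hsymm.comp π.contDiff.contDiffOn (fun y hy => hy), ?_⟩
  filter_upwards [e.open_source.mem_nhds hpe] with x hx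
  have := e.left_inv hx
  rwa [he_coe] at this

variable {E : Type*} [NormedAddCommGroup E] [NormedSpace ℝ E]

/-- **PUSH-FORWARD ALONG AN IMMERSION GERM, UNIFORMLY IN THE GERM.**  `Φ : X → Y` of class `C^n` (`n : ℕ∞`, `n ≥ 1`) on an open `O ∋ p` with injective derivative at `p` ⟹ there is
ONE neighbourhood `N` of `p` (depending on `Φ` only) such that EVERY global `C^n` map `H : X → E` is, on `N`, the pull-back `U ∘ Φ` of some GLOBAL `C^n` map `U : Y → E`
(`U := ρ • (H ∘ λ)` with `λ` the local left inverse of §2 and `ρ` a bump `= 1` near `Φ p` supported where `λ` is smooth — both chosen before `H`). [cite: Lee2012, Thm. 4.12; Lemma 2.26] -/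
theorem exists_nhds_forall_contDiff_comp_eq_of_injective_fderiv {n : ℕ∞} (hn : 1 ≤ n) {Φ : X → Y} {O : Set X} (hO : IsOpen O) {p : X} (hp : p ∈ O)
    (hΦ : ContDiffOn ℝ n Φ O) (hinj : Injective (fderiv ℝ Φ p)) :
    ∃ N ∈ 𝓝 p, ∀ H : X → E, ContDiff ℝ n H → ∃ U : Y → E, ContDiff ℝ n U ∧ ∀ x ∈ N, U (Φ x) = H x := by
  have hn' : (1 : WithTop ℕ∞) ≤ (n : WithTop ℕ∞) := by exact_mod_cast hn
  obtain ⟨V, hV, hpV, lam, hlam, hleft⟩ := exists_contDiffOn_leftInverse_of_injective_fderiv hn' hO hp hΦ hinj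
  -- a bump on `Y`, `= 1` near `Φ p`, supported in `V`
  obtain ⟨r, hr, hrV⟩ : ∃ r > 0, closedBall (Φ p) (2 * r) ⊆ V := by
    obtain ⟨r, hr, hrV⟩ := Metric.isOpen_iff.1 hV (Φ p) hpV
    refine ⟨r / 4, by positivity, (closedBall_subset_ball (by linarith)).trans hrV⟩
  let ρ : ContDiffBump (Φ p) := ⟨r, 2 * r, hr, by linarith⟩
  have hΦc : ContinuousAt Φ p := (hΦ.contDiffAt (hO.mem_nhds hp)).continuousAt
  refine ⟨{x | lam (Φ x) = x} ∩ Φ ⁻¹' ball (Φ p) r, inter_mem hleft (hΦc.preimage_mem_nhds (ball_mem_nhds _ hr)), fun H hH => ?_⟩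
  refine ⟨fun y => ρ y • H (lam y), ?_, fun x hx => ?_⟩
  · rw [contDiff_iff_contDiffAt]
    intro y
    by_cases hy : y ∈ V
    · exact ρ.contDiff.contDiffAt.smul (hH.contDiffAt.comp y (hlam.contDiffAt (hV.mem_nhds hy)))
    · have hy' : y ∉ tsupport (ρ : Y → ℝ) := fun h => hy (hrV (by simpa [ρ.tsupport_eq] using h))
      have h0 : (fun y => ρ y • H (lam y)) =ᶠ[𝓝 y] fun _ => 0 := by
        have : (ρ : Y → ℝ) =ᶠ[𝓝 y] 0 := by
          rw [← notMem_tsupport_iff_eventuallyEq]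
          exact hy'
        filter_upwards [this] with z hz
        simp only [hz, Pi.zero_apply, zero_smul]
      exact (contDiffAt_const (c := (0 : E))).congr_of_eventuallyEq h0
  · obtain ⟨hx1, hx2⟩ := hx
    have hρ : ρ (Φ x) = 1 := ρ.one_of_mem_closedBall (ball_subset_closedBall hx2)
    show ρ (Φ x) • H (lam (Φ x)) = H x
    rw [hρ, one_smul, hx1]

/-- **PUSH-FORWARD OF A SMOOTH GERM ALONG AN IMMERSION GERM.**  `Φ : X → Y` of class `C^n` (`n : ℕ∞`, `n ≥ 1`) near `p` with injective derivative at `p`, `H : X → E` of class `C^n` near `p` ⟹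
there is a GLOBAL `C^n` map `U : Y → E` with `U (Φ x) = H x` for every `x` near `p` (§1 makes `H` global first, then the uniform push-forward). [cite: Lee2012, Thm. 4.12; Lemma 2.26] -/
theorem exists_contDiff_comp_eventuallyEq_of_injective_fderiv {n : ℕ∞} (hn : 1 ≤ n) {Φ : X → Y} {O : Set X} (hO : IsOpen O) {p : X} (hp : p ∈ O)
    (hΦ : ContDiffOn ℝ n Φ O) (hinj : Injective (fderiv ℝ Φ p)) {H : X → E} (hH : ContDiffOn ℝ n H O) :
    ∃ U : Y → E, ContDiff ℝ n U ∧ ∀ᶠ x in 𝓝 p, U (Φ x) = H x := by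
  obtain ⟨N, hN, hall⟩ := exists_nhds_forall_contDiff_comp_eq_of_injective_fderiv (E := E) hn hO hp hΦ hinj
  obtain ⟨H', hH', hHH'⟩ := exists_contDiff_eventuallyEq_of_contDiffOn hO hp hH
  obtain ⟨U, hU, hUN⟩ := hall H' hH'
  refine ⟨U, hU, ?_⟩
  filter_upwards [hN, hHH'] with x hx hx'
  rw [hUN x hx, hx']

end Immersion

end Literature.Analysis.Calculus

end
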